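import Summits.ResolutionOfSingularities.ResolutionOfSingularities.Theorems.PurelyInseparableDim4AtlasShapeChartMem
import HarnessLib

/-!
# Purely inseparable four-folds: the LETTERS of the boundary propagate through a zigzag chart whose index is a centre variable
# (brick S3 (c) v4, tranche 2, brick «letters»; cell `res-dim4-pi`)

[OURS · counted 0] (D-0157 DOOR 2; host item stmt-ResolutionOfSingularities-16155, helper). Nothing here proves resolution of
singularities in dimension ≥ 4 / characteristic `p`. Tranche 1's `shapeT_transform_zigzag_of_chart_mem` (p714016) says: through the zigzag
chart of the re-centred chart `x_{j'}` (translation `b'`, `j' ∈ S''`), every component of the transformed boundary meeting the new region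
reads as SOME translated hyperplane, with injective index. Tranche 2 (`res-dim4-typ-3/S3c-V4-ATLAS-MEMBERS-DESIGN.md` §16, E-V4-4) books the
letters as DATA: this file is the same theorem with the letters NAMED — if every old component meeting the old region reads through a letter
of `L`, then every new component meeting the new region reads through a letter of
`insert (j', 0) {(i, c + b'_i) : (i, c) ∈ L, i ≠ j', (i ∉ S'' ∨ c + b'_i = 0)}` (= `childLetters j' b' S'' L` of the tranche-2 definitions):
the new exceptional divisor reads `(j', 0)`, the strict transform of an old component with letter `(i, c)`, `i ≠ j'`, reads `(i, c + b'_i)`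
(and misses the new region when `i ∈ S''`, `c + b'_i ≠ 0`), the one with index `j'` leaves the chart. Proof = p714016's, verbatim, plus the
membership bookkeeping.

* **`letters_transform_zigzag_of_chart_mem`**. AI-produced formalisation, weaker than expert review.
bears_on: LADDER-RESOLUTION:D157-DOOR2 (res-dim4-pi · S3 (c) v4 tranche 2 letters).
-/

set_option linter.dupNamespace false -- D-0017: single-problem summit path `Summit.<S>.<S>.…` by design

noncomputable section

open MvPolynomial Finset CategoryTheory CategoryTheory.Limits AlgebraicGeometry Opposite TopologicalSpace
open AlgebraicGeometry.Scheme.IdealSheafData (ofIdealTop vanishingIdeal)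

namespace Summit.ResolutionOfSingularities.ResolutionOfSingularities.Theorems.PIDim4

open Literature.AlgebraicGeometry.Resolution
open Literature.AlgebraicGeometry.Resolution.AffinePointBlowup (P A γ coord Wtop)

namespace Equimultiple

open ChartDictionary

section ShapeZigzagChartMemLetters

variable {K : Type} [Field K] {Z Y W Bl : Scheme.{0}} (φ : Y ⟶ Z) [IsOpenImmersion φ] (ψ : Y ⟶ P 4 K)
  [IsOpenImmersion ψ] {π : W ⟶ Z} {B : Bl ⟶ P 4 K}
  (ε : (π ⁻¹ᵁ φ.opensRange : Scheme.{0}) ≅ (B ⁻¹ᵁ ψ.opensRange : Scheme.{0}))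
  {S' S'' : Finset (Fin 4)} {j' : Fin 4} {b' : Fin 4 → K} {Θ' : A 4 K ≃ₐ[K] A 4 K}

/-- **THE LETTERS PROPAGATE through the zigzag chart of a chart whose index is a centre variable** (`j' ∈ S''`): tranche 1's
`shapeT_transform_zigzag_of_chart_mem` with the letters named — new exceptional divisor `(j', 0)`, strict transform of a meeting old
component with letter `(i, c)`, `i ≠ j'`, reads `(i, c + b'_i)`. [cite: BierstoneGrigorievMilmanWlodarczyk2011, Def. 3.1.3 (2)]
[cite: Hauser2010, §G (transform of the exceptional components)] -/
theorem letters_transform_zigzag_of_chart_mem [DecidableEq K] [IsLocallyNoetherian Z] [IsLocallyNoetherian W] [IsLocallyNoetherian Bl]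
    (Zc : Z.IdealSheafData)
    (hB : IsBlowup B (AffineCoordBlowup.𝓘Λ 4 K (insert 0 (Fin.succ '' (S' : Set (Fin 4))))))
    (hsq : ε.hom ≫ (B ∣_ ψ.opensRange) = (π ∣_ φ.opensRange) ≫ (φ.isoOpensRange.inv ≫ ψ.isoOpensRange.hom))
    (hC' : ((AffineCoordBlowup.𝓘Λ 4 K (insert 0 (Fin.succ '' (S' : Set (Fin 4))))).comap ψ.opensRange.ι).comap
        (φ.isoOpensRange.inv ≫ ψ.isoOpensRange.hom) = Zc.comap φ.opensRange.ι)
    (hj' : j' ∈ S') (hbj' : b' j' = 0) (hs' : ∀ i : Fin 4, Θ' (X i.succ) = X i.succ + C (b' i))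
    (hjS'' : j' ∈ S'') {E : List Z.IdealSheafData} (idx : Z.IdealSheafData → Fin 4) (cst : Z.IdealSheafData → K)
    (hshape : ∀ D ∈ E,
      ((D.support : Set Z) ∩ φ '' (ψ ⁻¹'
        (AffineCoordBlowup.CΛ 4 K (insert 0 (Fin.succ '' (S' : Set (Fin 4)))) : Set (P 4 K)))).Nonempty →
      D.comap φ = (ofIdealTop (Ideal.span {(γ 4 K).symm (X (idx D).succ + C (cst D))})).comap ψ ∧
        (idx D ∈ S' → cst D = 0))
    (hinj : ∀ D₁ ∈ E, ∀ D₂ ∈ E,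
      ((D₁.support : Set Z) ∩ φ '' (ψ ⁻¹'
        (AffineCoordBlowup.CΛ 4 K (insert 0 (Fin.succ '' (S' : Set (Fin 4)))) : Set (P 4 K)))).Nonempty →
      ((D₂.support : Set Z) ∩ φ '' (ψ ⁻¹'
        (AffineCoordBlowup.CΛ 4 K (insert 0 (Fin.succ '' (S' : Set (Fin 4)))) : Set (P 4 K)))).Nonempty →
      idx D₁ = idx D₂ → D₁ = D₂) (L : Finset (Fin 4 × K))
    (hL : ∀ D ∈ E,
      ((D.support : Set Z) ∩ φ '' (ψ ⁻¹'
        (AffineCoordBlowup.CΛ 4 K (insert 0 (Fin.succ '' (S' : Set (Fin 4)))) : Set (P 4 K)))).Nonempty → (idx D, cst D) ∈ L) :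
    ∃ (idx₂ : W.IdealSheafData → Fin 4) (cst₂ : W.IdealSheafData → K),
      (∀ D₂ ∈ E.map (strictTransformIdeal π Zc) ++ [Zc.comap π],
        ((D₂.support : Set W) ∩
          (((Spec.map (CommRingCat.ofHom (Θ' : A 4 K →+* A 4 K)) ≫
                AffineCoordBlowup.chartImm hB (succ_mem_centreVars hj')) ∣_ (B ⁻¹ᵁ ψ.opensRange)) ≫
              ε.inv ≫ (π ⁻¹ᵁ φ.opensRange).ι) ''
            (((Spec.map (CommRingCat.ofHom (Θ' : A 4 K →+* A 4 K)) ≫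
                AffineCoordBlowup.chartImm hB (succ_mem_centreVars hj')) ⁻¹ᵁ (B ⁻¹ᵁ ψ.opensRange)).ι ⁻¹'
              (AffineCoordBlowup.CΛ 4 K (insert 0 (Fin.succ '' (S'' : Set (Fin 4)))) : Set (P 4 K)))).Nonempty →
        D₂.comap (((Spec.map (CommRingCat.ofHom (Θ' : A 4 K →+* A 4 K)) ≫
              AffineCoordBlowup.chartImm hB (succ_mem_centreVars hj')) ∣_ (B ⁻¹ᵁ ψ.opensRange)) ≫
            ε.inv ≫ (π ⁻¹ᵁ φ.opensRange).ι) =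
          (ofIdealTop (Ideal.span {(γ 4 K).symm (X (idx₂ D₂).succ + C (cst₂ D₂))})).comap
            ((Spec.map (CommRingCat.ofHom (Θ' : A 4 K →+* A 4 K)) ≫
              AffineCoordBlowup.chartImm hB (succ_mem_centreVars hj')) ⁻¹ᵁ (B ⁻¹ᵁ ψ.opensRange)).ι ∧
        (idx₂ D₂ ∈ S'' → cst₂ D₂ = 0) ∧
        (idx₂ D₂, cst₂ D₂) ∈ insert (j', (0 : K))
          (((L.filter fun ic => ic.1 ≠ j').image fun ic => (ic.1, ic.2 + b' ic.1)).filter fun ic => ic.1 ∉ S'' ∨ ic.2 = 0)) ∧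
      (∀ D₁ ∈ E.map (strictTransformIdeal π Zc) ++ [Zc.comap π], ∀ D₂ ∈ E.map (strictTransformIdeal π Zc) ++ [Zc.comap π],
        ((D₁.support : Set W) ∩
          (((Spec.map (CommRingCat.ofHom (Θ' : A 4 K →+* A 4 K)) ≫
                AffineCoordBlowup.chartImm hB (succ_mem_centreVars hj')) ∣_ (B ⁻¹ᵁ ψ.opensRange)) ≫
              ε.inv ≫ (π ⁻¹ᵁ φ.opensRange).ι) ''
            (((Spec.map (CommRingCat.ofHom (Θ' : A 4 K →+* A 4 K)) ≫
                AffineCoordBlowup.chartImm hB (succ_mem_centreVars hj')) ⁻¹ᵁ (B ⁻¹ᵁ ψ.opensRange)).ι ⁻¹'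
              (AffineCoordBlowup.CΛ 4 K (insert 0 (Fin.succ '' (S'' : Set (Fin 4)))) : Set (P 4 K)))).Nonempty →
        ((D₂.support : Set W) ∩
          (((Spec.map (CommRingCat.ofHom (Θ' : A 4 K →+* A 4 K)) ≫
                AffineCoordBlowup.chartImm hB (succ_mem_centreVars hj')) ∣_ (B ⁻¹ᵁ ψ.opensRange)) ≫
              ε.inv ≫ (π ⁻¹ᵁ φ.opensRange).ι) ''
            (((Spec.map (CommRingCat.ofHom (Θ' : A 4 K →+* A 4 K)) ≫
                AffineCoordBlowup.chartImm hB (succ_mem_centreVars hj')) ⁻¹ᵁ (B ⁻¹ᵁ ψ.opensRange)).ι ⁻¹'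
              (AffineCoordBlowup.CΛ 4 K (insert 0 (Fin.succ '' (S'' : Set (Fin 4)))) : Set (P 4 K)))).Nonempty →
        idx₂ D₁ = idx₂ D₂ → D₁ = D₂) := by
  classical
  haveI : IsIso (CommRingCat.ofHom (Θ' : A 4 K →+* A 4 K)) :=
    (inferInstance : IsIso Θ'.toRingEquiv.toCommRingCatIso.hom)
  have hs'' : ∀ i : Fin 4, (Θ' : A 4 K →+* A 4 K) (X i.succ) = X i.succ + C (b' i) := fun i => hs' i
  have hΘ'j : (Θ' : A 4 K →+* A 4 K) (X j'.succ) = X j'.succ := by rw [hs'' j', hbj', C_0, add_zero]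
  have hΘC : ∀ r : K, (Θ' : A 4 K →+* A 4 K) (C r) = C r := fun r => Θ'.commutes r
  -- notation
  set φ₀ := Spec.map (CommRingCat.ofHom (Θ' : A 4 K →+* A 4 K)) ≫
    AffineCoordBlowup.chartImm hB (succ_mem_centreVars hj') with hφ₀
  set φ'' := (φ₀ ∣_ (B ⁻¹ᵁ ψ.opensRange)) ≫ ε.inv ≫ (π ⁻¹ᵁ φ.opensRange).ι with hφ''
  set ψ'' := (φ₀ ⁻¹ᵁ (B ⁻¹ᵁ ψ.opensRange)).ι with hψ''
  set T : Set Z := φ '' (ψ ⁻¹' (AffineCoordBlowup.CΛ 4 K (insert 0 (Fin.succ '' (S' : Set (Fin 4)))) : Set (P 4 K)))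
    with hT
  set T'' : Set W := φ'' '' (ψ'' ⁻¹'
    (AffineCoordBlowup.CΛ 4 K (insert 0 (Fin.succ '' (S'' : Set (Fin 4)))) : Set (P 4 K))) with hT''
  -- a strict transform meeting the new centre comes from a member meeting the old one
  have hsub_pre : T'' ⊆ π ⁻¹' T := image_next_centre_subset_preimage_zigzag_of_chart_mem φ ψ ε hB hsq hj' hbj' hs' hjS''
  have hmeet_old : ∀ D ∈ E, (((strictTransformIdeal π Zc D).support : Set W) ∩ T'').Nonempty →
      ((D.support : Set Z) ∩ T).Nonempty := by
    rintro D - ⟨w, hw1, hw2⟩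
    exact ⟨π w, support_strictTransformIdeal_subset_preimage π _ D hw1, hsub_pre hw2⟩
  -- the reading of a strict transform of a meeting member with index `≠ j'`
  have hread : ∀ D ∈ E, ((D.support : Set Z) ∩ T).Nonempty → idx D ≠ j' →
      (strictTransformIdeal π Zc D).comap φ'' =
        (ofIdealTop (Ideal.span {(γ 4 K).symm (X (idx D).succ + C (cst D + b' (idx D)))})).comap ψ'' := by
    intro D hD hm hij
    obtain ⟨hDi, hcst⟩ := hshape D hD hm
    have htr := zigzag_transport_strictTransform φ ψ ε _ Zc hsq hC' D _ hDi
    rw [hφ'', zigzag_transport_comap φ ψ ε φ₀ _ _ htr, hψ'']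
    congr 1
    by_cases hiS : idx D ∈ S'
    · have h0 : cst D = 0 := hcst hiS
      rw [h0, C_0, add_zero, zero_add, hφ₀]
      exact comap_hyperplane_chart hj' hij (hs'' (idx D)) hB
    · rw [hφ₀]
      exact comap_translate_hyperplane_chart hj' hiS (cst D) (hs'' (idx D)) hΘC hB
  -- the strict transform of a meeting member with index `j'` misses the new chart
  have hself : ∀ D ∈ E, ((D.support : Set Z) ∩ T).Nonempty → idx D = j' →
      ¬ (((strictTransformIdeal π Zc D).support : Set W) ∩ T'').Nonempty := by
    rintro D hD hm hij ⟨w, hw1, y, hy, rfl⟩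
    obtain ⟨hDi, hcst⟩ := hshape D hD hm
    rw [hcst (hij ▸ hj'), C_0, add_zero, hij] at hDi
    have htr := zigzag_transport_strictTransform φ ψ ε _ Zc hsq hC' D _ hDi
    have hmodel : (strictTransformIdeal B (AffineCoordBlowup.𝓘Λ 4 K (insert 0 (Fin.succ '' (S' : Set (Fin 4)))))
        (ofIdealTop (Ideal.span {(γ 4 K).symm (X j'.succ)}))).comap φ₀ = ⊤ :=
      comap_hyperplane_self_chart hj' _ hB
    have htop : (strictTransformIdeal π Zc D).comap φ'' = ⊤ := by
      rw [hφ'', zigzag_transport_comap φ ψ ε φ₀ _ _ htr, hmodel, Scheme.IdealSheafData.comap_top]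
    have h1 : y ∈ ((strictTransformIdeal π Zc D).comap φ'').support := by
      rw [Scheme.IdealSheafData.support_comap]; exact hw1
    rw [htop, Scheme.IdealSheafData.support_top] at h1
    exact h1
  -- the new exceptional divisor reads `ψ''^* V(x_{j'})`
  have hexc : ((AffineCoordBlowup.𝓘Λ 4 K (insert 0 (Fin.succ '' (S' : Set (Fin 4))))).comap B).comap φ₀ =
      ofIdealTop (Ideal.span {coord 4 K j'.succ}) :=
    comap_exceptional_chart hj' hΘ'j hB
  have hnew : (Zc.comap π).comap φ'' = (ofIdealTop (Ideal.span {(γ 4 K).symm (X j'.succ + C (0 : K))})).comap ψ'' := by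
    rw [hφ'', zigzag_transport_comap φ ψ ε φ₀ _ _ (zigzag_transport_centre φ ψ ε _ _ hsq hC'), hexc, C_0, add_zero]
    rfl
  -- a member reading `ψ''^* V(xᵢ + c)` with `i ∈ S''`, `c ≠ 0` does not meet the new centre
  have hmiss : ∀ (D₂ : W.IdealSheafData) (i : Fin 4) (c : K), i ∈ S'' → c ≠ 0 →
      D₂.comap φ'' = (ofIdealTop (Ideal.span {(γ 4 K).symm (X i.succ + C c)})).comap ψ'' →
      ¬ ((D₂.support : Set W) ∩ T'').Nonempty := by
    rintro D₂ i c hiS'' hc hr ⟨w, hw1, y, hy, rfl⟩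
    have h1 : y ∈ (D₂.comap φ'').support := by
      rw [Scheme.IdealSheafData.support_comap]; exact hw1
    rw [hr, Scheme.IdealSheafData.support_comap] at h1
    have h0 := support_translate_inter_CΛ_eq_empty (K := K) hc
      (Λ := insert 0 (Fin.succ '' (S'' : Set (Fin 4)))) (Set.mem_insert_of_mem _ ⟨_, hiS'', rfl⟩)
    exact (Set.eq_empty_iff_forall_notMem.mp h0) (ψ'' y) ⟨h1, hy⟩
  -- preimages of strict transforms among the meeting members
  let pre : W.IdealSheafData → Z.IdealSheafData := fun D₂ =>
    if h : ∃ D ∈ E, ((D.support : Set Z) ∩ T).Nonempty ∧ strictTransformIdeal π Zc D = D₂ then h.choose else ⊤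
  have hpre : ∀ D ∈ E, ((D.support : Set Z) ∩ T).Nonempty →
      pre (strictTransformIdeal π Zc D) ∈ E ∧ ((pre (strictTransformIdeal π Zc D)).support ∩ T : Set Z).Nonempty ∧
        strictTransformIdeal π Zc (pre (strictTransformIdeal π Zc D)) = strictTransformIdeal π Zc D := by
    intro D hD hm
    have hex : ∃ D' ∈ E, ((D'.support : Set Z) ∩ T).Nonempty ∧
        strictTransformIdeal π Zc D' = strictTransformIdeal π Zc D := ⟨D, hD, hm, rfl⟩
    simp only [pre, dif_pos hex]
    exact ⟨hex.choose_spec.1, hex.choose_spec.2.1, hex.choose_spec.2.2⟩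
  refine ⟨fun D₂ => if D₂ = Zc.comap π then j' else idx (pre D₂),
    fun D₂ => if D₂ = Zc.comap π then 0 else cst (pre D₂) + b' (idx (pre D₂)), ?_, ?_⟩
  · -- the readings
    intro D₂ hD₂ hm₂
    by_cases hnewD : D₂ = Zc.comap π
    · subst hnewD
      beta_reduce
      rw [if_pos rfl, if_pos rfl]
      exact ⟨hnew, fun _ => rfl, Finset.mem_insert_self _ _⟩
    · beta_reduce
      rw [if_neg hnewD, if_neg hnewD]
      rw [List.mem_append, List.mem_map, List.mem_singleton] at hD₂
      rcases hD₂ with ⟨D, hD, rfl⟩ | h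
      · have hm : ((D.support : Set Z) ∩ T).Nonempty := hmeet_old D hD hm₂
        obtain ⟨hpE, hpm, hpeq⟩ := hpre D hD hm
        have hpj : idx (pre (strictTransformIdeal π Zc D)) ≠ j' := fun h =>
          hself _ hpE hpm h (hpeq.symm ▸ hm₂)
        have hr := hread _ hpE hpm hpj
        rw [hpeq] at hr
        have hzero : idx (pre (strictTransformIdeal π Zc D)) ∈ S'' →
            cst (pre (strictTransformIdeal π Zc D)) + b' (idx (pre (strictTransformIdeal π Zc D))) = 0 := by
          intro hiS''
          by_contra hne
          exact hmiss _ _ _ hiS'' hne hr hm₂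
        refine ⟨hr, hzero, Finset.mem_insert_of_mem (Finset.mem_filter.mpr ⟨Finset.mem_image.mpr
          ⟨(idx (pre (strictTransformIdeal π Zc D)), cst (pre (strictTransformIdeal π Zc D))),
            Finset.mem_filter.mpr ⟨hL _ hpE hpm, hpj⟩, rfl⟩, ?_⟩)⟩
        by_cases hiS'' : idx (pre (strictTransformIdeal π Zc D)) ∈ S''
        · exact Or.inr (hzero hiS'')
        · exact Or.inl hiS''
      · exact absurd h hnewD
  · -- injectivity of the new index on the meeting members
    intro D₁ hD₁ D₂ hD₂ hm₁ hm₂ hidx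
    have key : ∀ D₀ ∈ E.map (strictTransformIdeal π Zc) ++ [Zc.comap π], D₀ ≠ Zc.comap π →
        (((D₀.support : Set W) ∩ T'').Nonempty) →
        pre D₀ ∈ E ∧ (((pre D₀).support : Set Z) ∩ T).Nonempty ∧ strictTransformIdeal π Zc (pre D₀) = D₀ ∧
          idx (pre D₀) ≠ j' := by
      intro D₀ hD₀ hne hm₀
      rw [List.mem_append, List.mem_map, List.mem_singleton] at hD₀
      rcases hD₀ with ⟨D, hD, rfl⟩ | h
      · obtain ⟨hpE, hpm, hpeq⟩ := hpre D hD (hmeet_old D hD hm₀)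
        exact ⟨hpE, hpm, hpeq, fun h => hself _ hpE hpm h (hpeq.symm ▸ hm₀)⟩
      · exact absurd h hne
    by_cases h₁ : D₁ = Zc.comap π <;> by_cases h₂ : D₂ = Zc.comap π
    · rw [h₁, h₂]
    · simp only [if_pos h₁, if_neg h₂] at hidx
      exact absurd hidx.symm (key D₂ hD₂ h₂ hm₂).2.2.2
    · simp only [if_neg h₁, if_pos h₂] at hidx
      exact absurd hidx (key D₁ hD₁ h₁ hm₁).2.2.2
    · simp only [if_neg h₁, if_neg h₂] at hidx
      obtain ⟨hp1E, hp1m, hp1eq, -⟩ := key D₁ hD₁ h₁ hm₁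
      obtain ⟨hp2E, hp2m, hp2eq, -⟩ := key D₂ hD₂ h₂ hm₂
      rw [← hp1eq, ← hp2eq, hinj _ hp1E _ hp2E hp1m hp2m hidx]



end ShapeZigzagChartMemLetters

end Equimultiple

end Summit.ResolutionOfSingularities.ResolutionOfSingularities.Theorems.PIDim4

end
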